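import Literature.AnabelianGeometry.EtaleTheta.TemperedFrobenioidOfThetaTwistTowerSmallIndex
import Literature.AnabelianGeometry.EtaleTheta.Discharge.Sec5OfQuotientTemperoidData
import Literature.AnabelianGeometry.EtaleTheta.Discharge.Sec5OfThetaSetting
import Literature.AnabelianGeometry.EtaleTheta.Discharge.Sec3Thm37Standard
import Literature.AnabelianGeometry.EtaleTheta.Discharge.Sec3Thm37ivGenuineBase
import HarnessLib

/-!
# [EtTh] §5 junction over the FOURTH tower model (small index, `K : Type 0`): the hypothesis-free inputs — [FrdI] Thm. 5.2
# hypotheses `h`, the `Ÿ`-choice §4 setting with `hopenY` DISCHARGED and `hH` a THEOREM, and the socket AT THE GENUINE `Π^tp_X̲̲` of a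
# `ThetaSetting` (Def. 3.6 (ii) p.303, Def. 4.1 pp.312–313, §5 pp.322, 330–331 / PDF pp.77, 86–87, 96, 104–105)

S. Mochizuki, *The étale theta function …*, Publ. RIMS **45** (2009) [MochizukiEtTh2009], Def. 3.6 (ii) p.303 (PDF p.77), Def. 4.1 (ii)
p.313 (PDF p.87), §5 p.322 (PDF p.96) («`A` arises from `X̲̲^log`»), pp.330–331 (PDF pp.104–105) («the natural surjective outer homomorphism
`Π^tp_X ↠ Aut_D(B_N^bs)`»); S. Mochizuki, *The geometry of Frobenioids I* (2008), Thm. 5.2 p.100 (standing hypotheses); S. Mochizuki,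
*Semi-graphs of anabelioids* (2006), Def. 3.1 (i) p.33, Rmk. 3.1.2–3.1.3 pp.33–34.
[cite: MochizukiEtTh2009, §5 p.330–331 (PDF pp.104–105)]  PAGE CONVENTION for [EtTh]: «printed N (PDF p.M)», N = M + 226.

abc-iut cell, layer L2, seat abc-iut-L2-t3 (gen 10; [EtTh] §3/§4 lineage, Def. 3.6 (ii) / `settingSmall` owner), row «JUNCTION-CENSUS@FOURTH-MODEL»
(abc-iut-L2-lead R1208) BUILD-ORDER STEP (1) = items D2 / S3 / S1 / D4 of the census memo
`HOME/staging/L2/L2-t3/g10/JUNCTION-CENSUS-FourthModel-L2t3g10.md`: every input of abc-iut-L2-t3's §5 datum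
`ThetaFrobenioid.ofQuotientTemperoidData` (p497260) over the small-index fourth model `ThetaTwistTowerSmallIndex.temperedFrobenioidSmall`
(p501267) that is producible TODAY without the theta-function / constants data, so that the data authors (abc-iut-L2-d2 (O6)/(O9),
abc-iut-L2-d3 F2/F3, abc-iut-L2-t11 hθ) plug into a ready socket.  ADDITIVE: nothing landed is edited or restated; ONE `def`
(`settingSmallYdd`, the `Ÿ`-choice twin of gen 9's `settingSmall`), everything else theorems.
* §1 **`hypotheses_temperedFrobenioidSmall`** — the [FrdI] Thm. 5.2 standing hypotheses `h` for the small-index fourth model, NO hypothesis: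
  `hBmon` from `hBinj` (`ofRlfZWeak_hBinj` fed by abc-iut-L2-t3's `ofTower_B₀_map_injective` along `toConnected`-images — the same
  injectivity behind `isFrobenioid_temperedFrobenioidSmall`) over the FSM-type base `B^temp(Compat₃′)⁰` (`isMonoidOn_ratFnFunctor_of_isOfFSMType`),
  then abc-iut-L2-t3's `hypotheses_treeCatVocab`.
* §2 `firstCountableTopology_compat₃` (instance-free: «GRP₃′» is induced from `Ẑ(1)³ × (Ẑˣ × ℤ)`, `Compat₃′` a subtype) ⇒
  **`isOpen_yddImage_compat₃`**: the input `hopenY` of abc-iut-L2-t3's `yddImage` / `mkOfQuotientTemperoidYdd` (p496572) DISCHARGED at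
  `G := Compat₃′` by the tree's open mapping theorem for first-countable tempered groups.
* §3 **`settingSmallYdd R S X φ hφ NH T ιX`** — the §4 setting over the small-index fourth model with the §5 choice `A_⊙^bs := Ÿ` read in
  `Compat₃′` (`A_⊙ := (Compat₃′/φ(ιX(Π^tp_Ÿ)), 0)`), at `X : TemperedArithmeticGroup.{0} K`, `T : ThetaEnvData.{0} N`; it IS
  `settingSmall … (yddImage …)` (`rfl`); laws BY NAME from p496572/p501267: `hH` a THEOREM (`hH_settingSmallYdd`), `Ker φ ≤ H_⊙`,
  `H_⊙`-membership, `GaloisSurjNatural`, `IsOpenKerGaloisSurj`, (L1) Galois torsors, A10 `BaseRootLaw «Galois»` (E2 (a) `rootLawC₃sf`).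
* §4 **AT THE GENUINE `Π^tp_X̲̲` OF A `ThetaSetting`**: with abc-iut-L2-t4's `X := C.temperedArithmeticGroup e` (p436226; `TemperedCurve.K : Type 0`),
  abc-iut-L2-t8's `T := C.thetaEnvData μ hC hS` and `ιX := refl`, the setting `settingSmallYdd R S (C.temperedArithmeticGroup e) φ hφ NH
  (C.thetaEnvData μ hC hS) (refl)` ELABORATES (the universe repair U1 was for exactly this), `Π^tp_Ÿ̲̲ ⊆ H_⊙` on the Setting's groups
  (`huu_mem_Hodot_settingSmallYdd_ofThetaSetting`), and the ENTRY theorem `exists_biKummerSetting_ofThetaSetting_small`: for every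
  continuous surjection `φ : Π^tp_X̲̲ ↠ Compat₃′` a §4/§5 setting over a MULTI-LEVEL tower model of Def. 3.6 (ii) with `Π^tp_Ÿ̲̲ ⊆ H_⊙`,
  Def. 4.1 (ii) naturality, open kernels and A10 EXISTS at the genuine tempered fundamental group.
HONEST COST displayed, not hidden (census S2, memo (J3b)): `φ : Π^tp_X̲̲ ↠ Compat₃′` continuous and ONTO is a HYPOTHESIS — the genuine
`g ↦ ((κ_ϖ, κ_Ü, κ_Θ̈)(g), χ(g), γ(g))` is not in the tree as a compatible Kummer-class system and is not onto (`χ(G_K) ⊊ Ẑˣ`); the carrier is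
abc-iut-L2-d2's class-(b) combinatorial DESIGN model re-indexed (NOT the tempered Frobenioid of a Tate curve); the theta function `Θ̈` as a
rational function, its fraction pair and roots (census D5, abc-iut-L2-d2 (O6)) and non-degenerate constants (D7, abc-iut-L2-d3 hull;
abc-iut-L2-t11's no-go p499346 stands at this countable carrier) are NOT supplied here.  [EtTh]/[FrdI]/[SemiAnbd] are refereed prerequisite
papers; nothing here bears on, or takes a side on, the disputed [IUTchIII] Cor. 3.12; nothing here asserts abc proved or refuted; typed ≠ proved.
-/

noncomputable section

namespace Literature.AnabelianGeometry.EtaleTheta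

open CategoryTheory Opposite Function Topology Literature.AlgebraicGeometry.Frobenioids Literature.AnabelianGeometry.SemiGraphs
  Literature.AnabelianGeometry.SemiGraphs.GaloisObjects LogDivisorModel LogDivisorModel.GaloisAction LogDivisorTower
  TateTowerKummerTwistRShear LogDivisorModel.TateTowerThetaTwist

namespace ThetaTwistTowerSmallIndex

open ThetaTwistTowerTempered

variable (R S : ((ConnectedPart (BTemp (Compat 3 thetaShear)))ᵒᵖ ⥤ CommMonCat.{0}) → Prop)

/-! ## §1 The [FrdI] Thm. 5.2 standing hypotheses `h` for the small-index fourth model — NO hypothesis -/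

/-- `hBinj` for the realified data of the small-index fourth model: every pull-back of `B₀^Λ = B₀` along a map of coset spaces is
injective (abc-iut-L2-t3's `ofTower_B₀_map_injective` read along `toConnected`). [cite: MochizukiEtTh2009, Def 3.6 p.303 (PDF p.77)] -/
theorem hBinj_small {Y Y' : (CosetCat (Compat 3 thetaShear))ᵒᵖ} (g : Y ⟶ Y') :
    Injective ((RealifiedDivisorMonoids.ofRlfZWeak dmSmall hpfSmall).BΛ.map g).hom :=
  RealifiedDivisorMonoids.ofRlfZWeak_hBinj dmSmall hpfSmall
    (fun g => towerC₃sf.ofTower_B₀_map_injective (toConn.map g.unop).op) g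

/-- **`hBmon`: `B` is a monoid on `B^temp(Compat₃′)⁰` for the small-index fourth model** ([FrdI] Def. 1.1 (ii); `hBinj` + FSM-type base).
[cite: MochizukiEtTh2009, Def 3.6 p.303 (PDF p.77)] -/
theorem isMonoidOn_ratFnFunctor_small : IsMonoidOn (temperedFrobenioidSmall R S).ratFnFunctor :=
  (temperedFrobenioidSmall R S).isMonoidOn_ratFnFunctor_of_isOfFSMType (fun g => hBinj_small g)
    QuasiTemperoid.BTempConnected.connectedPart_isOfFSMType

/-- **The [FrdI] Thm. 5.2 standing hypotheses HOLD for the Def. 3.6 (ii) data `(D, Φ, B, Div_B)` of the small-index fourth model**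
(`Φ` a divisorial monoid, `B` a group-like monoid, `D = B^temp(Compat₃′)⁰` connected and totally epimorphic) — the input `h` of the §5
datum `ThetaFrobenioid.ofQuotientTemperoidData`, NO hypothesis. [cite: MochizukiFrdI2008, Thm. 5.2 p.100] -/
theorem hypotheses_temperedFrobenioidSmall :
    ModelFrobenioid.Hypotheses (temperedFrobenioidSmall R S).divisorMonoid (temperedFrobenioidSmall R S).ratFnFunctor :=
  (temperedFrobenioidSmall R S).hypotheses_treeCatVocab (isMonoidOn_ratFnFunctor_small R S)

/-- In particular `Φ(A)` is divisorial at every `A` (the `hΦd` slot of the Prop. 4.2 / §5 law-level closers).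
[cite: MochizukiFrdI2008, Thm. 5.2 p.100] -/
theorem isDivisorial_small (A : ConnectedPart (BTemp (Compat 3 thetaShear))) :
    IsDivisorial ((temperedFrobenioidSmall R S).divisorMonoid.obj (op A)) :=
  (hypotheses_temperedFrobenioidSmall R S).isDivisorial A

/-! ## §2 `Compat₃′` is first countable; the input `hopenY` discharged at `G := Compat₃′` -/

/-- «GRP₃′» `= Ẑ(1)³ ⋊ (Ẑˣ × ℤ)` is first countable (its topology is induced from the first-countable product `Ẑ(1)³ × (Ẑˣ × ℤ)`; the
`Multiplicative` wrapper of the Kummer part is transparent for this purpose). [cite: MochizukiSemiAnbd2006, Def 3.1 (i) p.33] -/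
theorem firstCountableTopology_grp₃ : FirstCountableTopology (Grp 3 thetaShear) :=
  haveI : FirstCountableTopology (TateTowerKummerTwistR.Kum 3) :=
    (inferInstance : FirstCountableTopology (TateTowerKummerTwistR.KumAdd 3))
  (isInducing_leftRight 3 thetaShear).firstCountableTopology

/-- `Compat₃′ ≤ «GRP₃′»` is first countable. [cite: MochizukiSemiAnbd2006, Def 3.1 (i) p.33] -/
theorem firstCountableTopology_compat₃ : FirstCountableTopology (Compat 3 thetaShear) :=
  haveI := firstCountableTopology_grp₃
  Topology.IsInducing.subtypeVal.firstCountableTopology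

section Ydd

variable {K : Type} [Field K] (X : TemperedArithmeticGroup.{0} K) (φ : X.Pi →ₜ* Compat 3 thetaShear)
  (hφ : Function.Surjective φ)
  (NH : Subgroup (Field.absoluteGaloisGroup K) → (temperedFrobenioidSmall R S).category → ℕ+ → Prop)
  {N : ℕ+} (T : ThetaEnvData.{0} N) (ιX : T.PiX ≃ₜ* X.Pi)

include hφ in
/-- **The input `hopenY` DISCHARGED at `G := Compat₃′`**: the image `φ(ιX(Π^tp_Ÿ))` of the open subgroup `Π^tp_Ÿ` under a continuous
surjection `Π^tp_X ↠ Compat₃′` is open (the tree's open mapping theorem for first-countable tempered groups, abc-iut-L2-t3's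
`isOpen_yddImage_of_firstCountable`, p496572). [cite: MochizukiSemiAnbd2006, Def 3.1 (i) p.33] -/
theorem isOpen_yddImage_compat₃ : IsOpen (φ.toMonoidHom '' (ιX.toMonoidHom '' (T.PiYdd : Set T.PiX))) :=
  haveI := firstCountableTopology_compat₃
  BiKummerSetting.isOpen_yddImage_of_firstCountable X isTempered_compat₃' φ hφ T ιX

/-! ## §3 The `Ÿ`-choice §4 setting over the small-index fourth model -/

/-- **The §4 setting over the small-index fourth model with the §5 choice `A_⊙^bs := Ÿ` read in `Compat₃′`** (`A_⊙ :=
(Compat₃′/φ(ιX(Π^tp_Ÿ)), 0)`; §5 p.330 (PDF p.104): "the [Frobenius-trivial] object defined by the trivial line bundle over `Ÿ^log`"):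
abc-iut-L2-t3's `mkOfQuotientTemperoidYdd` (p496572) at `tf := temperedFrobenioidSmall R S`, `hopenY` discharged (§2).
[cite: MochizukiEtTh2009, §5 p.330 (PDF p.104)] -/
def settingSmallYdd : BiKummerSetting X (RealifiedDivisorMonoids.ofRlfZWeak dmSmall hpfSmall) (ConnectedPart (BTemp (Compat 3 thetaShear)))
    (treeCatVocab (ConnectedPart (BTemp (Compat 3 thetaShear))) R S) :=
  BiKummerSetting.mkOfQuotientTemperoidYdd X isTempered_compat₃' φ hφ (temperedFrobenioidSmall R S) rfl (hPSmall R S) NH T ιX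
    (isOpen_yddImage_compat₃ X φ hφ T ιX)

/-- `settingSmallYdd` IS gen 9's `settingSmall` at `M := yddImage …` (definitionally) — so `settingSmall_tf`, `_galoisSurjNatural`,
`_isOpenKerGaloisSurj`, `_Hodot`, `_baseRootLaw` (p501267) apply verbatim. [cite: MochizukiEtTh2009, Def 4.1 p.312 (PDF p.86)] -/
theorem settingSmallYdd_eq_settingSmall :
    settingSmallYdd R S X φ hφ NH T ιX =
      settingSmall R S X φ hφ NH (BiKummerSetting.yddImage X φ hφ T ιX (isOpen_yddImage_compat₃ X φ hφ T ιX)) := rfl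

/-- Its tempered Frobenioid is the small-index fourth model (definitionally). [cite: MochizukiEtTh2009, Def 4.1 p.312 (PDF p.86)] -/
theorem settingSmallYdd_tf : (settingSmallYdd R S X φ hφ NH T ιX).tf = temperedFrobenioidSmall R S := rfl

/-- **`H_⊙`-membership: `g ∈ H_⊙ ↔ φ g ∈ φ(ιX(Π^tp_Ÿ))`.** [cite: MochizukiEtTh2009, §5 p.330 (PDF p.104)] -/
theorem mem_Hodot_settingSmallYdd_iff (g : X.Pi) :
    g ∈ (settingSmallYdd R S X φ hφ NH T ιX).Hodot ↔ ∃ y ∈ T.PiYdd, φ (ιX y) = φ g :=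
  BiKummerSetting.mem_Hodot_mkOfQuotientTemperoidYdd_iff X isTempered_compat₃' φ hφ _ rfl (hPSmall R S) NH T ιX _ g

/-- **The §5 binder `hH` (`Π^tp_Ÿ ⊆ H_⊙`) is a THEOREM for the setting.** [cite: MochizukiEtTh2009, §5 p.330 (PDF p.104)] -/
theorem hH_settingSmallYdd : ∀ y : T.PiX, y ∈ T.PiYdd → ιX y ∈ (settingSmallYdd R S X φ hφ NH T ιX).Hodot :=
  BiKummerSetting.hH_mkOfQuotientTemperoidYdd X isTempered_compat₃' φ hφ _ rfl (hPSmall R S) NH T ιX _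

/-- `Ker φ ⊆ H_⊙`: the setting sees `Π^tp_X` only through `Compat₃′` (the honest content of re-basing).
[cite: MochizukiEtTh2009, §5 p.330 (PDF p.104)] -/
theorem ker_le_Hodot_settingSmallYdd : φ.toMonoidHom.ker ≤ (settingSmallYdd R S X φ hφ NH T ιX).Hodot :=
  BiKummerSetting.ker_le_Hodot_mkOfQuotientTemperoidYdd X isTempered_compat₃' φ hφ _ rfl (hPSmall R S) NH T ιX _

/-- **Def. 4.1 (ii) naturality** for the setting: a THEOREM. [cite: MochizukiEtTh2009, Def 4.1 (ii) p.313 (PDF p.87)] -/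
theorem settingSmallYdd_galoisSurjNatural : (settingSmallYdd R S X φ hφ NH T ιX).GaloisSurjNatural :=
  BiKummerSetting.mkOfQuotientTemperoid_galoisSurj_natural X isTempered_compat₃' φ hφ _ rfl (hPSmall R S) NH _ _ _

/-- **Def. 4.1 (ii), open kernels** for the setting: a THEOREM. [cite: MochizukiEtTh2009, Def 4.1 (ii) p.313 (PDF p.87)] -/
theorem settingSmallYdd_isOpenKerGaloisSurj : (settingSmallYdd R S X φ hφ NH T ιX).IsOpenKerGaloisSurj :=
  BiKummerSetting.mkOfQuotientTemperoid_isOpen_ker_galoisSurj X isTempered_compat₃' φ hφ _ rfl (hPSmall R S) NH _ _ _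

/-- **Law (L1) «Galois objects are `Aut`-torsors»** for the setting (binder `hGalT` of the §5 Prop. 5.5 files).
[cite: MochizukiSemiAnbd2006, Rmk 3.1.3 p.34] -/
theorem settingSmallYdd_galoisHomTorsor :
    ∀ ⦃A : ConnectedPart (BTemp (Compat 3 thetaShear))⦄, (settingSmallYdd R S X φ hφ NH T ιX).IsGaloisObj A →
      ∀ ⦃T' : ConnectedPart (BTemp (Compat 3 thetaShear))⦄ (b b' : A ⟶ T'), ∃ g : Aut A, b' = g.hom ≫ b :=
  BiKummerSetting.mkOfQuotientTemperoid_galoisHomTorsor X isTempered_compat₃' φ hφ _ rfl (hPSmall R S) NH _ _ _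

/-- **A10 `BaseRootLaw «Galois»` for the setting's tempered Frobenioid** (E2 (a) `rootLawC₃sf` through the small-index kit, p499867/p501267).
[cite: MochizukiEtTh2009, Prop 4.2 (iii) p.315 (PDF p.89)] -/
theorem settingSmallYdd_baseRootLaw :
    (settingSmallYdd R S X φ hφ NH T ιX).tf.BaseRootLaw (settingSmallYdd R S X φ hφ NH T ιX).IsGaloisObj :=
  baseRootLaw_galois_temperedFrobenioidSmall R S

/-- The anchor `A_⊙` of the setting is Frobenius-trivial with Galois base (its defining properties, by name).
[cite: MochizukiEtTh2009, Def 4.1 p.312 (PDF p.86)] -/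
theorem settingSmallYdd_isGalois_Aodot :
    IsGaloisObj (settingSmallYdd R S X φ hφ NH T ιX).Aodot.base.obj :=
  (settingSmallYdd R S X φ hφ NH T ιX).isGalois_Aodot

end Ydd

/-! ## §4 The socket AT THE GENUINE `Π^tp_X̲̲` of a `ThetaSetting` -/

section OfThetaSetting

variable {p : ℕ} [Fact p.Prime] {D : ThetaSetting p} {E : D.EtaleThetaData} {l : ℕ} (C : E.DoubleUnderline l)
  (e : D.toTemperedCurve.GroupLevelData) {N : ℕ+} (μ : D.CyclotomeMod l N) (hC : D.Compat) (hS : D.Sec2Hyps)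
  (φ : (C.temperedArithmeticGroup e).Pi →ₜ* Compat 3 thetaShear) (hφ : Function.Surjective φ)
  (NH : Subgroup (Field.absoluteGaloisGroup D.K) → (temperedFrobenioidSmall R S).category → ℕ+ → Prop)

/-- **The `Ÿ`-choice §4 setting over the small-index fourth model AT THE GENUINE `Π^tp_X̲̲ = C.Huu` of a `ThetaSetting`** — abc-iut-L2-t4's
`X := C.temperedArithmeticGroup e` (Type-0 field `K` of the Setting), abc-iut-L2-t8's `T := C.thetaEnvData μ hC hS`, `ιX := refl` — has
`H_⊙ ∋ g ↔ φ g ∈ φ(Π^tp_Ÿ̲̲)`. [cite: MochizukiEtTh2009, §5 p.322 (PDF p.96); p.330 (PDF p.104)] -/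
theorem mem_Hodot_settingSmallYdd_ofThetaSetting_iff (g : C.Huu) :
    g ∈ (settingSmallYdd R S (C.temperedArithmeticGroup e) φ hφ NH (C.thetaEnvData μ hC hS) (ContinuousMulEquiv.refl _)).Hodot ↔
      ∃ y ∈ (C.thetaEnvData μ hC hS).PiYdd, φ y = φ g :=
  mem_Hodot_settingSmallYdd_iff R S (C.temperedArithmeticGroup e) φ hφ NH (C.thetaEnvData μ hC hS) (ContinuousMulEquiv.refl _) g

/-- **`Π^tp_Ÿ̲̲ ⊆ H_⊙` at the genuine groups** (the §5 binder `hH` for the Setting's own `Π^tp_Ÿ̲̲ = Π^tp_Ÿ ∩ Π^tp_X̲̲`).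
[cite: MochizukiEtTh2009, §5 p.330 (PDF p.104)] -/
theorem hH_settingSmallYdd_ofThetaSetting :
    ∀ y : (C.thetaEnvData μ hC hS).PiX, y ∈ (C.thetaEnvData μ hC hS).PiYdd →
      y ∈ (settingSmallYdd R S (C.temperedArithmeticGroup e) φ hφ NH (C.thetaEnvData μ hC hS) (ContinuousMulEquiv.refl _)).Hodot :=
  hH_settingSmallYdd R S (C.temperedArithmeticGroup e) φ hφ NH (C.thetaEnvData μ hC hS) (ContinuousMulEquiv.refl _)

include φ hφ in
/-- **ENTRY THEOREM — at the GENUINE tempered fundamental group `Π^tp_X̲̲` of a `ThetaSetting`, for every continuous surjection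
`φ : Π^tp_X̲̲ ↠ Compat₃′`, there EXISTS a §4/§5 bi-Kummer setting over a multi-level tower model of Def. 3.6 (ii) (the small-index fourth
model; trivial `(N,H)`-slot) with `Π^tp_Ÿ̲̲ ⊆ H_⊙`, Def. 4.1 (ii) naturality, open kernels and A10 `BaseRootLaw «Galois»`** — the universe
repair U1 made a theorem at the Setting.  [cite: MochizukiEtTh2009, Def 4.1 p.312–313 (PDF pp.86–87); §5 p.330 (PDF p.104)] -/
theorem exists_biKummerSetting_ofThetaSetting_small :
    ∃ 𝔖 : BiKummerSetting (C.temperedArithmeticGroup e) (RealifiedDivisorMonoids.ofRlfZWeak dmSmall hpfSmall)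
        (ConnectedPart (BTemp (Compat 3 thetaShear))) (treeCatVocab (ConnectedPart (BTemp (Compat 3 thetaShear))) R S),
      𝔖.tf = temperedFrobenioidSmall R S ∧
      (∀ y : (C.thetaEnvData μ hC hS).PiX, y ∈ (C.thetaEnvData μ hC hS).PiYdd → y ∈ 𝔖.Hodot) ∧
      𝔖.GaloisSurjNatural ∧ 𝔖.IsOpenKerGaloisSurj ∧ 𝔖.tf.BaseRootLaw 𝔖.IsGaloisObj :=
  ⟨settingSmallYdd R S (C.temperedArithmeticGroup e) φ hφ (fun _ _ _ => True) (C.thetaEnvData μ hC hS) (ContinuousMulEquiv.refl _), rfl,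
    hH_settingSmallYdd_ofThetaSetting R S C e μ hC hS φ hφ _,
    settingSmallYdd_galoisSurjNatural R S _ φ hφ _ _ _, settingSmallYdd_isOpenKerGaloisSurj R S _ φ hφ _ _ _,
    settingSmallYdd_baseRootLaw R S _ φ hφ _ _ _⟩

end OfThetaSetting

end ThetaTwistTowerSmallIndex

end Literature.AnabelianGeometry.EtaleTheta

end
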